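import Summits.KontsevichZagierPeriods.Zeta5Search.Barrier.ConeGammaCuspSlopeLipschitz

/-!
# ζ(5) search — BARRIER: THE ENDPOINT JUMP FORM of a junction vote — jumps read AT the partition points, no point at `0`

HONEST FRAMING (cell `pub-zeta5`): systematic search; no irrationality claim unless kernel-certified. MODEL objects
under Brown–Zudilin's (28)+(30) accounting ([BZ22] = arXiv:2210.03391; (28) observed, not proved); nothing here is a
statement about `ζ(5)`, any `γ` of record, the cone's supremum (C2 OPEN) or the VALUE / SIGN of any vote at a named
direction (DATA of the cell); S-E stays CONJECTURED; records in print UNMOVED. Prover P2 g29, item «CONTINUITY AND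
PIECEWISE LINEARITY» (INBOX 2026-08-27), file (2); companion of `ConeGammaCuspGermDForm` / `ConeGammaCuspSlopeLipschitz`.

Along the local line `x ↦ θ_b + η(x·s(a) + δ)` at a junction `b ∈ bkpts a T`, member `k` (`b·h_k(a) ∈ ℤ`) has form
`η·h_k·(x − c_k)`, `c_k = −φ_k(δ)/h_k(a)`; AT a point `x` the saving sees exactly the THRESHOLD SET `{k : c_k ≤ x}` (a
member form `≥ 0` has the same floor as a positive one). Hence, for ANY weakly increasing chain
`−W = c_0 ≤ c_1 ≤ ⋯ ≤ c_n = W` containing the member flip times (repetitions allowed, the point `0` NOT required):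
* `torusN_eq_of_member_weakSigns` (g25's `torusN_eq_of_member_signs` with weak signs on the positive side),
  **`torusN_line_eq_of_same_thresholds`**, `wchain_mono`;
* `torusN_line_at_first` / `torusN_line_at_last` (`x = −W`: all members negative, the left orbit value; `x = c_{n−1}`:
  all members flipped, the right orbit value), `integral_baseline` (`∫_{−W}^{W} 𝒩(θ_b + ηw·s) dw = W·(N⁻ + N⁺)`),
  `integral_line_eq_sum_cells` (`∫_{−W}^{W} 𝒩(θ_b + η(w·s+δ)) dw = Σ_j (c_{j+1} − c_j)·𝒩(at c_j)`);
* **`germ_pair_eq_sum_endpoint_jumps`** — `K_b(δ) = germR + germL =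
  −Σ_{0<i<n} c_i·(𝒩(θ_b + η(c_i·s+δ)) − 𝒩(θ_b + η(c_{i−1}·s+δ)))` (Abel; the baseline integrates to `W·(N⁻+N⁺)` and
  cancels against the boundary terms);
* `endpoint_jump_eq_zero_of_no_member` (a partition point that is no member's flip time carries no jump),
  `sum_endpoint_jumps` (the jumps add up to the orbit jump `N⁺ − N⁻`).
DESK (DATA, `HOME/pub-zeta5-p2/g29/alg/facelin.py`): the kink census finds no kink of `σ` on the hyperplanes `φ_k(δ) = 0`
(0 of 6), as this form predicts. NOT here: anything about `γ`, C2, S-E, `ζ(5)`.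
-/

noncomputable section

open Set MeasureTheory
open scoped Topology

namespace Summit.KontsevichZagierPeriods.Zeta5Search.Barrier.ConeGamma

/-! ### Weak member signs and threshold sets -/

/-- **Near a breakpoint the saving sees only the WEAK SIGNS of the member forms**: two small displacements whose
member forms are both `≥ 0` or both `< 0`, member by member, give the same saving (a member form in `[0,1)` has floor
`b·h_k`, one in `(−1,0)` has floor `b·h_k − 1`; non-member floors are frozen). -/
theorem torusN_eq_of_member_weakSigns {a : Dir} {T b : ℝ} (hb : b ∈ bkpts a T) {Δ Δ' : Fin 8 → ℝ}
    (hΔ1 : ∀ k, |phiForm Δ k| < 1) (hΔ2 : ∀ k, |phiForm Δ k| < wallDist a T)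
    (hΔ'1 : ∀ k, |phiForm Δ' k| < 1) (hΔ'2 : ∀ k, |phiForm Δ' k| < wallDist a T)
    (hsign : ∀ k, (∃ z : ℤ, b * h28 a k = z) →
      (0 ≤ phiForm Δ k ∧ 0 ≤ phiForm Δ' k) ∨ (phiForm Δ k < 0 ∧ phiForm Δ' k < 0)) :
    torusN (b • sParam a + Δ) = torusN (b • sParam a + Δ') := by
  refine torusN_congr_floor fun i j hij => ?_
  wlog hlt : i < j generalizing i j
  · have hji : j < i := lt_of_le_of_ne (not_lt.mp hlt) (Ne.symm hij)
    rw [pairForm_comm _ i j, pairForm_comm (b • sParam a + Δ') i j]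
    exact this j i hij.symm hji
  rw [pairForm_add, pairForm_add, pairForm_eq_phiForm_idxOf _ hlt, pairForm_eq_phiForm_idxOf _ hlt,
    pairForm_eq_phiForm_idxOf _ hlt, phiForm_smul_sParam]
  by_cases hm : ∃ z : ℤ, b * h28 a (idxOf i j) = z
  · obtain ⟨z, hz⟩ := hm
    rcases hsign _ ⟨z, hz⟩ with ⟨hp, hp'⟩ | ⟨hn, hn'⟩
    · rw [hz, Int.floor_intCast_add, Int.floor_intCast_add, Int.floor_eq_zero_iff.mpr ⟨hp, (abs_lt.mp (hΔ1 _)).2⟩,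
        Int.floor_eq_zero_iff.mpr ⟨hp', (abs_lt.mp (hΔ'1 _)).2⟩]
    · rw [hz, floor_intCast_add_of_neg_gt_neg_one (abs_lt.mp (hΔ1 _)).1 hn,
        floor_intCast_add_of_neg_gt_neg_one (abs_lt.mp (hΔ'1 _)).1 hn']
  · push Not at hm
    have key : ∀ Δ'' : Fin 8 → ℝ, (∀ k, |phiForm Δ'' k| < wallDist a T) →
        ⌊b * h28 a (idxOf i j) + phiForm Δ'' (idxOf i j)⌋ = ⌊b * h28 a (idxOf i j)⌋ := fun Δ'' hΔ'' => by
      simpa only [one_mul] using floor_add_mul_eq_of_nonmember (x := b * h28 a (idxOf i j))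
        (y := phiForm Δ'' (idxOf i j)) (fun z => (hΔ'' _).trans_le (wallDist_le hb _ hm z)) zero_le_one le_rfl
    rw [key Δ hΔ2, key Δ' hΔ'2]

/-- **AT a local time the saving sees exactly the threshold set `{k member : c_k ≤ x}`.** For `b ∈ bkpts a T`, an
admissible `η` and `x, y ∈ [−W, W]` with `c_k ≤ x ↔ c_k ≤ y` for every member `k` (`c_k = −φ_k(δ)/h_k(a)`):
`𝒩(θ_b + η(x·s+δ)) = 𝒩(θ_b + η(y·s+δ))`. -/
theorem torusN_line_eq_of_same_thresholds {a : Dir} (hpos : ∀ k, 0 < h28 a k) {T b : ℝ} (hb : b ∈ bkpts a T)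
    (δ : Fin 8 → ℝ) {η : ℝ} (hη : 0 < η) (h1 : η * clusterBound a δ < 1) (h2 : η * clusterBound a δ < wallDist a T)
    {x y : ℝ} (hx : |x| ≤ clusterWidth a δ) (hy : |y| ≤ clusterWidth a δ)
    (hsame : ∀ k, (∃ z : ℤ, b * h28 a k = z) → (-(phiForm δ k / h28 a k) ≤ x ↔ -(phiForm δ k / h28 a k) ≤ y)) :
    torusN (b • sParam a + η • (x • sParam a + δ)) = torusN (b • sParam a + η • (y • sParam a + δ)) := by
  obtain ⟨hx1, hx2⟩ := disp_small hpos δ hη h1 h2 hx (T := T)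
  obtain ⟨hy1, hy2⟩ := disp_small hpos δ hη h1 h2 hy (T := T)
  refine torusN_eq_of_member_weakSigns hb hx1 hx2 hy1 hy2 fun k hk => ?_
  have hk0 := hpos k
  rw [phiForm_disp, phiForm_disp, line_form_eq_mul_sub hk0 rfl, line_form_eq_mul_sub hk0 rfl]
  by_cases hcx : -(phiForm δ k / h28 a k) ≤ x
  · exact Or.inl ⟨mul_nonneg hη.le (mul_nonneg hk0.le (sub_nonneg.mpr hcx)),
      mul_nonneg hη.le (mul_nonneg hk0.le (sub_nonneg.mpr ((hsame k hk).mp hcx)))⟩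
  · have hcy : ¬ -(phiForm δ k / h28 a k) ≤ y := fun h => hcx ((hsame k hk).mpr h)
    exact Or.inr ⟨mul_neg_of_pos_of_neg hη (mul_neg_of_pos_of_neg hk0 (sub_neg.mpr (lt_of_not_ge hcx))),
      mul_neg_of_pos_of_neg hη (mul_neg_of_pos_of_neg hk0 (sub_neg.mpr (lt_of_not_ge hcy)))⟩

/-- Monotonicity of a weakly increasing chain. -/
theorem wchain_mono {c : ℕ → ℝ} {n : ℕ} (hmono : ∀ j < n, c j ≤ c (j + 1)) {i j : ℕ} (hij : i ≤ j) (hj : j ≤ n) :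
    c i ≤ c j := by
  induction j with
  | zero => rw [Nat.le_zero.mp hij]
  | succ m ih =>
    rcases Nat.lt_or_eq_of_le hij with h | h
    · exact (ih (Nat.lt_succ_iff.mp h) (Nat.le_of_succ_le hj)).trans (hmono m (Nat.lt_of_succ_le hj))
    · rw [h]

/-- Every point of a weakly increasing chain from `−W` to `W` lies in `[−W, W]`. -/
theorem abs_wchain_le {W : ℝ} {c : ℕ → ℝ} {n : ℕ} (hc0 : c 0 = -W) (hcn : c n = W)
    (hmono : ∀ j < n, c j ≤ c (j + 1)) {i : ℕ} (hi : i ≤ n) : |c i| ≤ W :=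
  abs_le.mpr ⟨hc0 ▸ wchain_mono hmono (Nat.zero_le i) hi, hcn ▸ wchain_mono hmono hi le_rfl⟩

/-! ### The two ends of the line: orbit values -/

/-- **At `x = −W` every member is negative**: `𝒩(θ_b + η((−W)·s + δ)) = 𝒩(θ_b − t·s)` for any line step `t`. -/
theorem torusN_line_at_first {a : Dir} (hpos : ∀ k, 0 < h28 a k) {T b : ℝ} (hb : b ∈ bkpts a T)
    (δ : Fin 8 → ℝ) {η : ℝ} (hη : 0 < η) (h1 : η * clusterBound a δ < 1) (h2 : η * clusterBound a δ < wallDist a T)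
    {t : ℝ} (ht : 0 < t) (ht1 : t * xMax a < 1) (ht2 : t * xMax a < wallDist a T) :
    torusN (b • sParam a + η • ((-clusterWidth a δ) • sParam a + δ)) = torusN (b • sParam a - t • sParam a) := by
  have hW := clusterWidth_pos hpos δ
  obtain ⟨hx1, hx2⟩ := disp_small hpos δ hη h1 h2 (x := -clusterWidth a δ)
    (by rw [abs_neg, abs_of_pos hW]) (T := T)
  have hB1 := fun k => phiForm_line_step_small hpos ht ht1 k
  have hB2 := fun k => phiForm_line_step_small hpos ht ht2 k
  rw [sub_eq_add_neg, ← neg_smul]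
  refine torusN_eq_of_member_weakSigns hb hx1 hx2 (fun k => (hB1 k).2.2.2.2) (fun k => (hB2 k).2.2.2.2)
    fun k _ => Or.inr ⟨?_, by rw [(hB1 k).2.1]; linarith [(hB1 k).2.2.1]⟩
  have hk0 := hpos k
  have hc := abs_lt.mp (abs_flip_lt_clusterWidth hpos δ k)
  rw [phiForm_disp, line_form_eq_mul_sub hk0 rfl]
  exact mul_neg_of_pos_of_neg hη (mul_neg_of_pos_of_neg hk0 (by linarith [hc.1]))

/-- **At the last interior point every member has flipped**: for a weakly increasing chain `−W = c_0 ≤ ⋯ ≤ c_n = W`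
containing the member flip times and `0 < n`, `𝒩(θ_b + η(c_{n−1}·s + δ)) = 𝒩(θ_b + t·s)` for any line step `t` (a
member flip time `c_i` has `i ≠ n` since it lies inside `(−W, W)`, so `c_i ≤ c_{n−1}`). -/
theorem torusN_line_at_last {a : Dir} (hpos : ∀ k, 0 < h28 a k) {T b : ℝ} (hb : b ∈ bkpts a T)
    (δ : Fin 8 → ℝ) {η : ℝ} (hη : 0 < η) (h1 : η * clusterBound a δ < 1) (h2 : η * clusterBound a δ < wallDist a T)
    {t : ℝ} (ht : 0 < t) (ht1 : t * xMax a < 1) (ht2 : t * xMax a < wallDist a T)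
    {n : ℕ} {c : ℕ → ℝ} (hn : 0 < n) (hc0 : c 0 = -clusterWidth a δ) (hcn : c n = clusterWidth a δ)
    (hmono : ∀ j < n, c j ≤ c (j + 1))
    (hflip : ∀ k, (∃ z : ℤ, b * h28 a k = z) → ∃ i ≤ n, c i = -(phiForm δ k / h28 a k)) :
    torusN (b • sParam a + η • (c (n - 1) • sParam a + δ)) = torusN (b • sParam a + t • sParam a) := by
  obtain ⟨hx1, hx2⟩ := disp_small hpos δ hη h1 h2 (abs_wchain_le hc0 hcn hmono (Nat.sub_le n 1)) (T := T)
  have hB1 := fun k => phiForm_line_step_small hpos ht ht1 k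
  have hB2 := fun k => phiForm_line_step_small hpos ht ht2 k
  refine torusN_eq_of_member_weakSigns hb hx1 hx2 (fun k => (hB1 k).2.2.2.1) (fun k => (hB2 k).2.2.2.1)
    fun k hk => Or.inl ⟨?_, by rw [(hB1 k).1]; exact (hB1 k).2.2.1.le⟩
  have hk0 := hpos k
  obtain ⟨i, hin, hci⟩ := hflip k hk
  have hin' : i ≠ n := by
    rintro rfl
    have hW := abs_flip_lt_clusterWidth hpos δ k
    rw [← neg_neg (phiForm δ k / h28 a k), ← hci, abs_neg, hcn, abs_of_pos (clusterWidth_pos hpos δ)] at hW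
    exact lt_irrefl _ hW
  have hle : c i ≤ c (n - 1) := wchain_mono hmono (Nat.le_sub_one_of_lt (lt_of_le_of_ne hin hin')) (Nat.sub_le n 1)
  rw [phiForm_disp, line_form_eq_mul_sub hk0 hci]
  exact mul_nonneg hη.le (mul_nonneg hk0.le (sub_nonneg.mpr hle))

/-! ### The two integrals over `[−W, W]` -/

/-- The line `w ↦ 𝒩(θ_b + η(w·s + δ))` is interval integrable. -/
theorem intervalIntegrable_torusN_localLine (a : Dir) (δ : Fin 8 → ℝ) (b η α β : ℝ) :
    IntervalIntegrable (fun w : ℝ => (torusN (b • sParam a + η • (w • sParam a + δ)) : ℝ)) volume α β := by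
  have h := intervalIntegrable_torusN_affine a (η • δ) b η α β
  refine (intervalIntegrable_congr fun w _ => ?_).mp h
  simp only [(bkpt_disp_affine a b η w δ).1]

/-- The baseline `w ↦ 𝒩(θ_b + (ηw)·s)` is interval integrable. -/
theorem intervalIntegrable_torusN_baseline (a : Dir) (b η α β : ℝ) :
    IntervalIntegrable (fun w : ℝ => (torusN (b • sParam a + (η * w) • sParam a) : ℝ)) volume α β := by
  have h := intervalIntegrable_torusN_affine a 0 b η α β
  refine (intervalIntegrable_congr fun w _ => ?_).mp h
  simp only [add_zero, add_smul]

/-- **The baseline integrates to `W·(N⁻ + N⁺)`**: `∫_{−W}^{W} 𝒩(θ_b + (ηw)·s) dw = W·(𝒩(θ_b − t·s) + 𝒩(θ_b + t·s))`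
for any line step `t` (all members negative left of `0`, positive right of `0`). -/
theorem integral_baseline {a : Dir} (hpos : ∀ k, 0 < h28 a k) {T b : ℝ} (hb : b ∈ bkpts a T)
    (δ : Fin 8 → ℝ) {η : ℝ} (hη : 0 < η) (h1 : η * clusterBound a δ < 1) (h2 : η * clusterBound a δ < wallDist a T)
    {t : ℝ} (ht : 0 < t) (ht1 : t * xMax a < 1) (ht2 : t * xMax a < wallDist a T) :
    ∫ w in (-clusterWidth a δ)..clusterWidth a δ, (torusN (b • sParam a + (η * w) • sParam a) : ℝ) =
      clusterWidth a δ * ((torusN (b • sParam a - t • sParam a) : ℝ) + torusN (b • sParam a + t • sParam a)) := by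
  have hW := clusterWidth_pos hpos δ
  have hGi := intervalIntegrable_torusN_baseline a b η
  rw [← intervalIntegral.integral_add_adjacent_intervals (hGi _ 0) (hGi 0 _)]
  have hL : ∫ w in (-clusterWidth a δ)..0, (torusN (b • sParam a + (η * w) • sParam a) : ℝ) =
      ∫ _ in (-clusterWidth a δ)..0, (torusN (b • sParam a - t • sParam a) : ℝ) := by
    refine intervalIntegral.integral_congr_ae ?_
    have hae : ∀ᵐ x ∂volume, x ∉ ({0} : Set ℝ) := (measure_eq_zero_iff_ae_notMem).mp (measure_singleton _)
    filter_upwards [hae] with x hx0 hxI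
    rw [uIoc_of_le (by linarith : -clusterWidth a δ ≤ 0)] at hxI
    have hxlt : x < 0 := lt_of_le_of_ne hxI.2 fun h => hx0 (Set.mem_singleton_iff.mpr h)
    rw [torusN_lineStep_eq_of_neg hpos hb δ hη h1 h2 ht ht1 ht2 hxlt hxI.1.le]
  have hR : ∫ w in (0 : ℝ)..clusterWidth a δ, (torusN (b • sParam a + (η * w) • sParam a) : ℝ) =
      ∫ _ in (0 : ℝ)..clusterWidth a δ, (torusN (b • sParam a + t • sParam a) : ℝ) := by
    refine intervalIntegral.integral_congr_ae (Filter.Eventually.of_forall fun x hxI => ?_)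
    rw [uIoc_of_le hW.le] at hxI
    rw [torusN_lineStep_eq_of_pos hpos hb δ hη h1 h2 ht ht1 ht2 hxI.1 hxI.2]
  rw [hL, hR, intervalIntegral.integral_const, intervalIntegral.integral_const, smul_eq_mul, smul_eq_mul]
  ring

/-- **Cell decomposition with endpoint values.** For a weakly increasing chain `−W = c_0 ≤ ⋯ ≤ c_n = W` containing the
member flip times: `∫_{−W}^{W} 𝒩(θ_b + η(w·s+δ)) dw = Σ_{j<n} (c_{j+1} − c_j)·𝒩(θ_b + η(c_j·s+δ))` (on the open cell
`(c_j, c_{j+1})` the threshold set is that of `c_j`; degenerate cells contribute `0`). -/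
theorem integral_line_eq_sum_cells {a : Dir} (hpos : ∀ k, 0 < h28 a k) {T b : ℝ} (hb : b ∈ bkpts a T)
    (δ : Fin 8 → ℝ) {η : ℝ} (hη : 0 < η) (h1 : η * clusterBound a δ < 1) (h2 : η * clusterBound a δ < wallDist a T)
    {n : ℕ} {c : ℕ → ℝ} (hc0 : c 0 = -clusterWidth a δ) (hcn : c n = clusterWidth a δ)
    (hmono : ∀ j < n, c j ≤ c (j + 1))
    (hflip : ∀ k, (∃ z : ℤ, b * h28 a k = z) → ∃ i ≤ n, c i = -(phiForm δ k / h28 a k)) :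
    ∫ w in (-clusterWidth a δ)..clusterWidth a δ, (torusN (b • sParam a + η • (w • sParam a + δ)) : ℝ) =
      ∑ j ∈ Finset.range n, (c (j + 1) - c j) * (torusN (b • sParam a + η • (c j • sParam a + δ)) : ℝ) := by
  have hIi := intervalIntegrable_torusN_localLine a δ b η
  rw [← hc0, ← hcn, ← intervalIntegral.sum_integral_adjacent_intervals fun k _ => hIi (c k) (c (k + 1))]
  refine Finset.sum_congr rfl fun j hj => ?_
  have hj' : j < n := Finset.mem_range.mp hj
  have hle : c j ≤ c (j + 1) := hmono j hj'
  have hcj : |c j| ≤ clusterWidth a δ := abs_wchain_le hc0 hcn hmono hj'.le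
  have hcongr : ∫ x in (c j)..(c (j + 1)), (torusN (b • sParam a + η • (x • sParam a + δ)) : ℝ) =
      ∫ _ in (c j)..(c (j + 1)), (torusN (b • sParam a + η • (c j • sParam a + δ)) : ℝ) := by
    refine intervalIntegral.integral_congr_ae ?_
    have hae : ∀ᵐ x ∂volume, x ∉ ({c (j + 1)} : Set ℝ) :=
      (measure_eq_zero_iff_ae_notMem).mp (measure_singleton _)
    filter_upwards [hae] with x hxB hxI
    rw [uIoc_of_le hle] at hxI
    have hxlt : x < c (j + 1) := lt_of_le_of_ne hxI.2 fun h => hxB (Set.mem_singleton_iff.mpr h)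
    have hxW : |x| ≤ clusterWidth a δ := by
      have hlo : -clusterWidth a δ ≤ c j := by rw [← hc0]; exact wchain_mono hmono (Nat.zero_le j) hj'.le
      have hhi : c (j + 1) ≤ clusterWidth a δ := by rw [← hcn]; exact wchain_mono hmono hj' le_rfl
      exact abs_le.mpr ⟨by linarith [hxI.1], by linarith⟩
    have hN : torusN (b • sParam a + η • (x • sParam a + δ)) = torusN (b • sParam a + η • (c j • sParam a + δ)) := by
      refine torusN_line_eq_of_same_thresholds hpos hb δ hη h1 h2 hxW hcj fun k hk => ?_
      obtain ⟨i, hin, hci⟩ := hflip k hk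
      refine ⟨fun hix => ?_, fun hij => hij.trans hxI.1.le⟩
      rcases le_or_gt i j with hij | hji
      · exact hci.ge.trans (wchain_mono hmono hij hj'.le)
      · have h' : c (j + 1) ≤ c i := wchain_mono hmono (Nat.succ_le_of_lt hji) hin
        linarith [hci.le]
    rw [hN]
  rw [hcongr, intervalIntegral.integral_const, smul_eq_mul]

/-! ### The endpoint jump form -/

/-- **THE ENDPOINT JUMP FORM OF A JUNCTION VOTE.** Let all 28 forms of `a` be positive, `b ∈ bkpts a T`, `δ` a
displacement, `η` admissible (`ηK < 1`, `ηK < wallDist a T`), and `−W = c_0 ≤ c_1 ≤ ⋯ ≤ c_n = W` ANY weakly increasing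
chain containing every member flip time `−φ_k(δ)/h_k(a)` (repeated points allowed; the point `0` is not required). Then
`germR(δ)(b) + germL(δ)(b) = −Σ_{0<i<n} c_i·(𝒩(θ_b + η(c_i·s+δ)) − 𝒩(θ_b + η(c_{i−1}·s+δ)))`: the vote is the sum
over the partition points of (local time) × (jump of the saving read AT the points). -/
theorem germ_pair_eq_sum_endpoint_jumps {a : Dir} (hpos : ∀ k, 0 < h28 a k) {T b : ℝ} (hb : b ∈ bkpts a T)
    (δ : Fin 8 → ℝ) {η : ℝ} (hη : 0 < η) (h1 : η * clusterBound a δ < 1) (h2 : η * clusterBound a δ < wallDist a T)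
    {n : ℕ} {c : ℕ → ℝ} (hc0 : c 0 = -clusterWidth a δ) (hcn : c n = clusterWidth a δ)
    (hmono : ∀ j < n, c j ≤ c (j + 1))
    (hflip : ∀ k, (∃ z : ℤ, b * h28 a k = z) → ∃ i ≤ n, c i = -(phiForm δ k / h28 a k)) :
    germR a δ η b + germL a δ η b =
      -∑ i ∈ Finset.Ico 1 n, c i *
        ((torusN (b • sParam a + η • (c i • sParam a + δ)) : ℝ) -
          torusN (b • sParam a + η • (c (i - 1) • sParam a + δ))) := by
  have hW := clusterWidth_pos hpos δ
  have hn : 0 < n := Nat.pos_of_ne_zero (by rintro rfl; rw [hc0] at hcn; linarith)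
  obtain ⟨ht, ht1, ht2⟩ := lineStep_small hpos (T := T) δ hη h1 h2 hW le_rfl
  -- K = ∫ F − ∫ G over [−W, W]
  have hsplit : germR a δ η b + germL a δ η b =
      (∫ w in (-clusterWidth a δ)..clusterWidth a δ, (torusN (b • sParam a + η • (w • sParam a + δ)) : ℝ)) -
        ∫ w in (-clusterWidth a δ)..clusterWidth a δ, (torusN (b • sParam a + (η * w) • sParam a) : ℝ) := by
    rw [germ_pair_eq_integral, ← intervalIntegral.integral_sub (intervalIntegrable_torusN_localLine a δ b η _ _)
      (intervalIntegrable_torusN_baseline a b η _ _)]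
    exact intervalIntegral.integral_congr fun w _ => shiftDiff_line a δ η b w
  have hB := integral_baseline hpos hb δ hη h1 h2 ht ht1 ht2
  have hF := integral_line_eq_sum_cells hpos hb δ hη h1 h2 hc0 hcn hmono hflip
  have hA := sum_cells_abel c (fun j => (torusN (b • sParam a + η • (c j • sParam a + δ)) : ℝ)) hn
  have hlast : (torusN (b • sParam a + η • (c (n - 1) • sParam a + δ)) : ℝ) =
      torusN (b • sParam a + (η * clusterWidth a δ) • sParam a) := by
    exact_mod_cast torusN_line_at_last hpos hb δ hη h1 h2 ht ht1 ht2 hn hc0 hcn hmono hflip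
  have hfirst : (torusN (b • sParam a + η • (c 0 • sParam a + δ)) : ℝ) =
      torusN (b • sParam a - (η * clusterWidth a δ) • sParam a) := by
    rw [hc0]; exact_mod_cast torusN_line_at_first hpos hb δ hη h1 h2 ht ht1 ht2
  have hsum : ∑ i ∈ Finset.Ico 1 n, c i *
      ((torusN (b • sParam a + η • (c (i - 1) • sParam a + δ)) : ℝ) -
        torusN (b • sParam a + η • (c i • sParam a + δ))) =
      -∑ i ∈ Finset.Ico 1 n, c i *
        ((torusN (b • sParam a + η • (c i • sParam a + δ)) : ℝ) -
          torusN (b • sParam a + η • (c (i - 1) • sParam a + δ))) := by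
    rw [← Finset.sum_neg_distrib]
    exact Finset.sum_congr rfl fun i _ => by ring
  rw [hsplit, hB, hF, hA, hsum, hlast, hfirst, hcn, hc0]
  ring

/-- **A partition point that is no member's flip time carries no jump**: under the chain hypotheses, for `0 < i < n`
with `c_i ≠ −φ_k(δ)/h_k(a)` for every member `k`, `𝒩(θ_b + η(c_i·s+δ)) = 𝒩(θ_b + η(c_{i−1}·s+δ))`. -/
theorem endpoint_jump_eq_zero_of_no_member {a : Dir} (hpos : ∀ k, 0 < h28 a k) {T b : ℝ} (hb : b ∈ bkpts a T)
    (δ : Fin 8 → ℝ) {η : ℝ} (hη : 0 < η) (h1 : η * clusterBound a δ < 1) (h2 : η * clusterBound a δ < wallDist a T)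
    {n : ℕ} {c : ℕ → ℝ} (hc0 : c 0 = -clusterWidth a δ) (hcn : c n = clusterWidth a δ)
    (hmono : ∀ j < n, c j ≤ c (j + 1))
    (hflip : ∀ k, (∃ z : ℤ, b * h28 a k = z) → ∃ i ≤ n, c i = -(phiForm δ k / h28 a k))
    {i : ℕ} (hi0 : 0 < i) (hin : i < n) (hno : ∀ k, (∃ z : ℤ, b * h28 a k = z) → c i ≠ -(phiForm δ k / h28 a k)) :
    torusN (b • sParam a + η • (c i • sParam a + δ)) = torusN (b • sParam a + η • (c (i - 1) • sParam a + δ)) := by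
  refine torusN_line_eq_of_same_thresholds hpos hb δ hη h1 h2 (abs_wchain_le hc0 hcn hmono hin.le)
    (abs_wchain_le hc0 hcn hmono (by omega)) fun k hk => ?_
  obtain ⟨i', hi'n, hci'⟩ := hflip k hk
  refine ⟨fun hle => ?_, fun hle => hle.trans (wchain_mono hmono (Nat.sub_le i 1) hin.le)⟩
  have hne : c i' ≠ c i := fun h => hno k hk (h.symm.trans hci')
  have hlt : c i' < c i := lt_of_le_of_ne (hci'.le.trans hle) hne
  by_cases hii : i ≤ i'
  · exact absurd (wchain_mono hmono hii hi'n) (not_le.mpr hlt)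
  · exact hci'.ge.trans (wchain_mono hmono (by omega : i' ≤ i - 1) (by omega))

/-- **The endpoint jumps add up to the orbit jump**: `Σ_{0<i<n} (𝒩(at c_i) − 𝒩(at c_{i−1})) = 𝒩(θ_b + t·s) − 𝒩(θ_b − t·s)`
for any line step `t`. -/
theorem sum_endpoint_jumps {a : Dir} (hpos : ∀ k, 0 < h28 a k) {T b : ℝ} (hb : b ∈ bkpts a T)
    (δ : Fin 8 → ℝ) {η : ℝ} (hη : 0 < η) (h1 : η * clusterBound a δ < 1) (h2 : η * clusterBound a δ < wallDist a T)
    {t : ℝ} (ht : 0 < t) (ht1 : t * xMax a < 1) (ht2 : t * xMax a < wallDist a T)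
    {n : ℕ} {c : ℕ → ℝ} (hn : 0 < n) (hc0 : c 0 = -clusterWidth a δ) (hcn : c n = clusterWidth a δ)
    (hmono : ∀ j < n, c j ≤ c (j + 1))
    (hflip : ∀ k, (∃ z : ℤ, b * h28 a k = z) → ∃ i ≤ n, c i = -(phiForm δ k / h28 a k)) :
    ∑ i ∈ Finset.Ico 1 n,
        (torusN (b • sParam a + η • (c i • sParam a + δ)) - torusN (b • sParam a + η • (c (i - 1) • sParam a + δ))) =
      torusN (b • sParam a + t • sParam a) - torusN (b • sParam a - t • sParam a) := by
  rw [Finset.sum_Ico_eq_sum_range,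
    Finset.sum_congr rfl fun k _ => by rw [Nat.add_sub_cancel_left, Nat.add_comm 1 k],
    Finset.sum_range_sub (fun j => torusN (b • sParam a + η • (c j • sParam a + δ))),
    torusN_line_at_last hpos hb δ hη h1 h2 ht ht1 ht2 hn hc0 hcn hmono hflip, hc0,
    torusN_line_at_first hpos hb δ hη h1 h2 ht ht1 ht2]

end Summit.KontsevichZagierPeriods.Zeta5Search.Barrier.ConeGamma

end
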